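import Mathlib
import Literature.Combinatorics.SimpleGraph.PaleySos
import Literature.Combinatorics.SimpleGraph.PaleySosProofs
import Literature.NumberTheory.LFunctions.HybridCharSumWeil
import HarnessLib

/-!
# Signed edge patterns on a random injective patch of the Paley graph are small-biased

Stub `stub_paleyPatternBias` (N) of line `weil-patch-transfer` for crux `PaleySosRung`
(stmt-PneNP-9817): for every `k` there is `C = C(k) ≥ 0` (we take `C = 8k`) such that for all
primes `p ≡ 1 (mod 4)`, all `m` and every nonempty pattern `E` of at most `k` ordered pairs
`(a < b)` of `Fin m`,
`|Σ_{x : Fin m ↪ Fin p} Π_{(a,b) ∈ E} sgn(x a ∼ x b)| ≤ (C/√p) · #(Fin m ↪ Fin p)` (`sgn = ±1` the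
edge sign of `paleyGraph p`).

Proof. For distinct `u, v ∈ 𝔽_p` (`p ≡ 1 (mod 4)`), `sgn(u ∼ v) = χ(u − v)`, `χ` the quadratic
character (tree: `paleyGraph_adj_iff_quadraticChar`); with `w` the least first coordinate
occurring in `E` (never a second coordinate) the summand is `χ(Π_{(w,b) ∈ E} (x w − x b)) · χ(Q)`,
`Q` free of `x w`.
* Support reduction (`card_mul_sum_embedding_trans`): the summand only depends on `x` restricted
  to the support `V = {w} ⊔ U` of `E` (`|U| < 2k`); the symmetric group of the target acts
  transitively on embeddings (Mathlib's `Equiv.Perm.exists_smul_eq_embedding`) and restriction is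
  equivariant, so `#(V ↪ 𝔽_p) · Σ_{x : Fin m ↪ 𝔽_p} f(x|_V) = #(Fin m ↪ 𝔽_p) · Σ_{y : V ↪ 𝔽_p} f y`.
* Apex last (`abs_sum_option_embedding_le`): an embedding of `Option U` is an embedding `u` of `U`
  plus a fresh value `z` (Mathlib's `optionEmbeddingEquiv`); for fixed `u` the complete sum
  `Σ_{z ∈ 𝔽_p} χ(Π_b (z − u b))` has modulus `≤ deg · √p` by the Weil bound PROVED in the tree
  (`HybridLFunction.norm_hybridSum_le`, Schmidt II.2G / Weil 1948, at `b = 0`), the roots `u b`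
  being distinct, and each of the `≤ |U|` excluded values of `z` costs at most `1`.
* Numerics: `|Σ| ≤ (k√p + 2k − 1)/(p − 2k + 1) · # ≤ (8k/√p) · #` for `p ≥ 16k²`; for `p < 16k²`
  the trivial bound `|Σ| ≤ #` suffices because `8k ≥ √p`.
-/

set_option linter.dupNamespace false -- `Summit.PneNP.PneNP.…`: summit = sub-problem (D-0017)

namespace Summit.PneNP.PneNP.Theorems.PaleySosRungWeilPatch

open Literature.Combinatorics.SimpleGraph Finset

/-! ### Averaging over the symmetric group of the target -/

/-- **Orbit averaging.** If `π : δ → (α' ↪ β)` is equivariant for the symmetric group of `β`, then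
`#Sym(β) · Σ_d g(π d) = #δ · Σ_σ g(σ • y₀)` for any base point `y₀`: the action of `Sym(β)` on
`α' ↪ β` is transitive (Mathlib's `Equiv.Perm.exists_smul_eq_embedding`), so all orbit sums
agree. [folklore] -/
theorem card_perm_mul_sum_eq {α' β δ : Type*} [Fintype α'] [Fintype β] [DecidableEq β]
    [Fintype δ] [MulAction (Equiv.Perm β) δ] (π : δ → (α' ↪ β))
    (hπ : ∀ (σ : Equiv.Perm β) (d : δ), π (σ • d) = σ • π d) (g : (α' ↪ β) → ℝ)
    (y₀ : α' ↪ β) :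
    (Fintype.card (Equiv.Perm β) : ℝ) * ∑ d, g (π d) =
      Fintype.card δ * ∑ σ : Equiv.Perm β, g (σ • y₀) := by
  have horbit : ∀ y₁ : α' ↪ β,
      ∑ σ : Equiv.Perm β, g (σ • y₁) = ∑ σ : Equiv.Perm β, g (σ • y₀) := by
    intro y₁
    obtain ⟨τ, rfl⟩ := Equiv.Perm.exists_smul_eq_embedding y₀ y₁
    simp_rw [smul_smul]
    exact Fintype.sum_equiv (Equiv.mulRight τ) (fun σ => g ((σ * τ) • y₀))
      (fun σ => g (σ • y₀)) fun σ => rfl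
  have key : ∀ σ : Equiv.Perm β, ∑ d, g (π d) = ∑ d, g (σ • π d) := by
    intro σ
    rw [← Fintype.sum_equiv (MulAction.toPerm σ) (fun d => g (π (σ • d))) (fun d => g (π d))
      fun d => rfl]
    simp_rw [hπ]
  calc (Fintype.card (Equiv.Perm β) : ℝ) * ∑ d, g (π d)
      = ∑ σ : Equiv.Perm β, ∑ d, g (σ • π d) := by
        rw [← sum_congr rfl fun σ _ => key σ, sum_const, card_univ, nsmul_eq_mul]
    _ = ∑ d, ∑ σ : Equiv.Perm β, g (σ • π d) := sum_comm
    _ = ∑ _d : δ, ∑ σ : Equiv.Perm β, g (σ • y₀) := sum_congr rfl fun d _ => horbit _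
    _ = _ := by rw [sum_const, card_univ, nsmul_eq_mul]

/-- **Support reduction.** For an embedding `ι : α' ↪ α` and any weight `g` on embeddings
`α' ↪ β`, `#(α' ↪ β) · Σ_{x : α ↪ β} g(x ∘ ι) = #(α ↪ β) · Σ_{y : α' ↪ β} g(y)` (restriction along
`ι` is equivariant; apply `card_perm_mul_sum_eq` to it and to the identity). [folklore] -/
theorem card_mul_sum_embedding_trans {α α' β : Type*} [Fintype α] [Fintype α'] [Fintype β]
    [DecidableEq α] [DecidableEq α'] [DecidableEq β] (ι : α' ↪ α) (g : (α' ↪ β) → ℝ) :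
    (Fintype.card (α' ↪ β) : ℝ) * ∑ x : α ↪ β, g (ι.trans x) =
      (Fintype.card (α ↪ β) : ℝ) * ∑ y : α' ↪ β, g y := by
  rcases isEmpty_or_nonempty (α' ↪ β) with hE | ⟨⟨y₀⟩⟩
  · simp
  have hP : (0 : ℝ) < Fintype.card (Equiv.Perm β) := by exact_mod_cast Fintype.card_pos
  have h1 : (Fintype.card (Equiv.Perm β) : ℝ) * ∑ x : α ↪ β, g (ι.trans x) =
      Fintype.card (α ↪ β) * ∑ σ : Equiv.Perm β, g (σ • y₀) :=
    card_perm_mul_sum_eq (fun x : α ↪ β => ι.trans x)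
      (fun σ x => by ext a; simp [Function.Embedding.smul_apply]) g y₀
  have h2 : (Fintype.card (Equiv.Perm β) : ℝ) * ∑ y : α' ↪ β, g y =
      Fintype.card (α' ↪ β) * ∑ σ : Equiv.Perm β, g (σ • y₀) :=
    card_perm_mul_sum_eq (fun y : α' ↪ β => y) (fun _ _ => rfl) g y₀
  refine mul_left_cancel₀ hP.ne' ?_
  linear_combination (Fintype.card (α' ↪ β) : ℝ) * h1 - (Fintype.card (α ↪ β) : ℝ) * h2

/-- Inequality form of `card_mul_sum_embedding_trans`: a bias bound of ratio `B` for a weight read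
on the sub-vertex-type `α'` transfers to `α` with the same ratio. [folklore] -/
theorem abs_sum_embedding_trans_le {α α' β : Type*} [Fintype α] [Fintype α'] [Fintype β]
    [DecidableEq α] [DecidableEq α'] [DecidableEq β] (ι : α' ↪ α) (g : (α' ↪ β) → ℝ) {B : ℝ}
    (hB : |∑ y : α' ↪ β, g y| ≤ B * Fintype.card (α' ↪ β)) :
    |∑ x : α ↪ β, g (ι.trans x)| ≤ B * Fintype.card (α ↪ β) := by
  have h := card_mul_sum_embedding_trans (β := β) ι g
  rcases isEmpty_or_nonempty (α' ↪ β) with hE | hne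
  · haveI : IsEmpty (α ↪ β) := ⟨fun x => hE.elim (ι.trans x)⟩
    simp
  · have hpos : (0 : ℝ) < Fintype.card (α' ↪ β) := by exact_mod_cast Fintype.card_pos
    have heq : ∑ x : α ↪ β, g (ι.trans x) =
        (Fintype.card (α ↪ β) : ℝ) / Fintype.card (α' ↪ β) * ∑ y : α' ↪ β, g y := by
      rw [div_mul_eq_mul_div, eq_div_iff hpos.ne', mul_comm, h]
    rw [heq, abs_mul, abs_div, Nat.abs_cast, Nat.abs_cast]
    calc (Fintype.card (α ↪ β) : ℝ) / Fintype.card (α' ↪ β) * |∑ y : α' ↪ β, g y|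
        ≤ (Fintype.card (α ↪ β) : ℝ) / Fintype.card (α' ↪ β) * (B * Fintype.card (α' ↪ β)) :=
          mul_le_mul_of_nonneg_left hB (by positivity)
      _ = B * Fintype.card (α ↪ β) := by
          rw [mul_comm B, ← mul_assoc, div_mul_cancel₀ _ hpos.ne', mul_comm]

/-! ### The Weil bound, apex last -/

/-- `|χ(a)| ≤ 1` for the quadratic character, as a real number. [folklore] -/
theorem abs_quadraticChar_le_one {F : Type*} [Field F] [Fintype F] [DecidableEq F] (a : F) :
    |(quadraticChar F a : ℝ)| ≤ 1 := by
  by_cases ha : a = 0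
  · simp [ha]
  · rcases quadraticChar_dichotomy ha with h | h <;> rw [h] <;> simp

/-- **Weil's bound for a complete character sum of a split square-free polynomial** (Schmidt,
Ch. II, Theorem 2C; the tree's `HybridLFunction.norm_hybridSum_le` at the trivial twist `b = 0`):
for distinct roots `r_i` (`i ∈ s`, `s ≠ ∅`) in `𝔽_p`, `p ≡ 1 (mod 4)`,
`|Σ_{z ∈ 𝔽_p} χ(Π_{i ∈ s} (z − r_i))| ≤ |s| √p`. [folklore] -/
theorem abs_sum_quadraticChar_prod_sub_le (n : ℕ) [Fact (n + 1).Prime] (h4 : (n + 1) % 4 = 1)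
    {κ : Type*} (s : Finset κ) (hs : s.Nonempty) (r : κ → ZMod (n + 1)) (hr : Set.InjOn r s) :
    |∑ z : ZMod (n + 1), (quadraticChar (ZMod (n + 1)) (∏ i ∈ s, (z - r i)) : ℝ)| ≤
      s.card * Real.sqrt (n + 1) := by
  have hρ : Function.Injective (fun i : Fin s.card => r (s.equivFin.symm i)) := by
    intro i j hij
    exact s.equivFin.symm.injective
      (Subtype.ext (hr (s.equivFin.symm i).2 (s.equivFin.symm j).2 hij))
  have hprod : ∀ z : ZMod (n + 1),
      ∏ i ∈ s, (z - r i) = ∏ i : Fin s.card, (z - r (s.equivFin.symm i)) := by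
    intro z
    rw [← prod_coe_sort s]
    exact Fintype.prod_equiv s.equivFin (fun i => z - r i) _ fun i => by simp
  have h := Literature.NumberTheory.LFunctions.HybridLFunction.norm_hybridSum_le (ZMod (n + 1))
    (ringChar_zmod_ne_two h4) (ZMod.isPrimitive_stdAddChar (n + 1)) one_ne_zero hρ hs.card_pos 0
  simp only [one_mul, zero_mul, AddChar.map_zero_eq_one, mul_one,
    Literature.NumberTheory.LFunctions.HybridLFunction.quadChar_apply, ZMod.card, Nat.cast_add,
    Nat.cast_one] at h
  rw [← Int.cast_sum, Complex.norm_intCast, Int.cast_sum] at h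
  simp_rw [hprod]
  exact h

/-- **Summing the apex last.** On the vertex type `Option γ` with apex `none`: if the weight of an
embedding `y` is `χ(Π_{e ∈ S} (y none − R e))` — the roots `R e` (`e ∈ S ≠ ∅`) being distinct and
depending only on `u = y ∘ some` — times a factor `Φ₂(u)` of modulus `≤ 1`, then
`|Σ_y weight(y)| ≤ (|S| √p + #γ) · #(γ ↪ 𝔽_p)`: for fixed `u` the complete sum over the apex value
`z ∈ 𝔽_p` is Weil-bounded (`abs_sum_quadraticChar_prod_sub_le`) and the `≤ #γ` forbidden values
`z ∈ range u` cost at most `1` each. [folklore] -/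
theorem abs_sum_option_embedding_le (n : ℕ) [Fact (n + 1).Prime] (h4 : (n + 1) % 4 = 1)
    {γ : Type*} [Fintype γ] [DecidableEq γ] {κ : Type*} (S : Finset κ) (hS : S.Nonempty)
    (R : (γ ↪ ZMod (n + 1)) → κ → ZMod (n + 1)) (hR : ∀ u, Set.InjOn (R u) S)
    (Φ₂ : (γ ↪ ZMod (n + 1)) → ℝ) (hΦ₂ : ∀ u, |Φ₂ u| ≤ 1) :
    |∑ y : Option γ ↪ ZMod (n + 1),
        (quadraticChar (ZMod (n + 1))
            (∏ e ∈ S, (y none - R (Function.Embedding.some.trans y) e)) : ℝ) *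
          Φ₂ (Function.Embedding.some.trans y)| ≤
      (S.card * Real.sqrt (n + 1) + Fintype.card γ) * Fintype.card (γ ↪ ZMod (n + 1)) := by
  classical
  obtain ⟨G, hG⟩ : ∃ G : (γ ↪ ZMod (n + 1)) → ZMod (n + 1) → ℝ, ∀ u z,
      G u z = (quadraticChar (ZMod (n + 1)) (∏ e ∈ S, (z - R u e)) : ℝ) := ⟨_, fun _ _ => rfl⟩
  have hG1 : ∀ u z, |G u z| ≤ 1 := fun u z => by rw [hG]; exact abs_quadraticChar_le_one _
  -- reindex the sum by pairs `(u, z)` with `z ∉ range u` and bound the inner sums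
  rw [Fintype.sum_equiv (Function.Embedding.optionEmbeddingEquiv γ (ZMod (n + 1))) _
    (fun q => G q.1 q.2 * Φ₂ q.1) (fun y => by rw [hG]; rfl), Fintype.sum_sigma]
  have hinner : ∀ u : γ ↪ ZMod (n + 1),
      |∑ z : ↥(Set.range ⇑u)ᶜ, G u z * Φ₂ u| ≤ S.card * Real.sqrt (n + 1) + Fintype.card γ := by
    intro u
    rw [← Finset.sum_mul, abs_mul]
    have hsub : ∑ z ∈ (univ.image ⇑u)ᶜ, G u z = ∑ z : ↥(Set.range ⇑u)ᶜ, G u z :=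
      Finset.sum_subtype _ (fun z => by simp) _
    have hsplit : ∑ z ∈ (univ.image ⇑u)ᶜ, G u z = ∑ z, G u z - ∑ z ∈ univ.image ⇑u, G u z := by
      rw [eq_sub_iff_add_eq, Finset.sum_compl_add_sum]
    have hW : |∑ z, G u z| ≤ S.card * Real.sqrt (n + 1) := by
      simpa only [hG] using abs_sum_quadraticChar_prod_sub_le n h4 S hS (R u) (hR u)
    have hex : |∑ z ∈ univ.image ⇑u, G u z| ≤ Fintype.card γ :=
      calc |∑ z ∈ univ.image ⇑u, G u z| ≤ ∑ z ∈ univ.image ⇑u, |G u z| := abs_sum_le_sum_abs _ _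
        _ ≤ ∑ _z ∈ univ.image ⇑u, (1 : ℝ) := sum_le_sum fun z _ => hG1 u z
        _ = (univ.image ⇑u).card := by simp
        _ ≤ Fintype.card γ := by exact_mod_cast card_image_le.trans (card_univ (α := γ)).le
    calc |∑ z : ↥(Set.range ⇑u)ᶜ, G u z| * |Φ₂ u|
        ≤ (S.card * Real.sqrt (n + 1) + Fintype.card γ) * 1 := by
          refine mul_le_mul ?_ (hΦ₂ u) (abs_nonneg _) (by positivity)
          rw [← hsub, hsplit]
          exact (abs_sub _ _).trans (add_le_add hW hex)
      _ = _ := mul_one _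
  calc |∑ u : γ ↪ ZMod (n + 1), ∑ z : ↥(Set.range ⇑u)ᶜ, G u z * Φ₂ u|
      ≤ ∑ u : γ ↪ ZMod (n + 1), |∑ z : ↥(Set.range ⇑u)ᶜ, G u z * Φ₂ u| := abs_sum_le_sum_abs _ _
    _ ≤ ∑ _u : γ ↪ ZMod (n + 1), (S.card * Real.sqrt (n + 1) + Fintype.card γ) :=
        sum_le_sum fun u _ => hinner u
    _ = _ := by rw [sum_const, card_univ, nsmul_eq_mul, mul_comm]

/-! ### The pattern sum over `𝔽_p`-valued embeddings -/

/-- **The bias bound for large `p`.** For `p = n + 1 ≡ 1 (mod 4)` prime with `p ≥ 16k²` and a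
nonempty pattern `E` of `≤ k` ordered pairs `(a < b)` of `Fin m`,
`|Σ_{x : Fin m ↪ 𝔽_p} Π_{(a,b)∈E} sgn(x a ∼ x b)| ≤ (8k/√p) · #(Fin m ↪ 𝔽_p)` (support reduction to
`{w} ⊔ U`, `w` the least first coordinate, then the apex `w` summed last by Weil). [folklore] -/
theorem abs_sum_pattern_le_of_le (n : ℕ) [Fact (n + 1).Prime] (h4 : (n + 1) % 4 = 1) {k m : ℕ}
    (hbig : 16 * k ^ 2 ≤ n + 1) [DecidableRel (paleyGraph (n + 1)).Adj]
    {E : Finset (Fin m × Fin m)} (hne : E.Nonempty) (hEk : E.card ≤ k)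
    (hlt : ∀ e ∈ E, e.1 < e.2) :
    |∑ x : Fin m ↪ ZMod (n + 1),
        ∏ e ∈ E, (if (paleyGraph (n + 1)).Adj (x e.1) (x e.2) then (1 : ℝ) else -1)| ≤
      8 * k / Real.sqrt (n + 1) * Fintype.card (Fin m ↪ ZMod (n + 1)) := by
  classical
  have hk : 1 ≤ k := hne.card_pos.trans_le hEk
  -- the apex `w`: the least first coordinate of `E`; it is never a second coordinate
  obtain ⟨w, hwA, hwmin⟩ : ∃ w, w ∈ E.image Prod.fst ∧ ∀ e ∈ E, w ≤ e.1 :=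
    ⟨_, min'_mem _ (hne.image _), fun e he => min'_le _ _ (mem_image_of_mem _ he)⟩
  have hw2 : ∀ e ∈ E, e.2 ≠ w := fun e he => ((hwmin e he).trans_lt (hlt e he)).ne'
  -- the support of `E` minus the apex
  obtain ⟨U, hUmem, hUk⟩ : ∃ U : Finset (Fin m),
      (∀ i, i ∈ U ↔ i ≠ w ∧ (i ∈ E.image Prod.fst ∨ i ∈ E.image Prod.snd)) ∧
        U.card + 1 ≤ 2 * k := by
    refine ⟨(E.image Prod.fst ∪ E.image Prod.snd).erase w,
      fun i => by rw [mem_erase, mem_union], ?_⟩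
    rw [card_erase_of_mem (mem_union_left _ hwA)]
    have h₁ := card_union_le (E.image Prod.fst) (E.image Prod.snd)
    have h₂ : (E.image Prod.fst).card ≤ E.card := card_image_le
    have h₃ : (E.image Prod.snd).card ≤ E.card := card_image_le
    have h₄ := card_pos.2 ⟨w, mem_union_left (E.image Prod.snd) hwA⟩
    omega
  have hU2 : ∀ e ∈ E, e.2 ∈ U := fun e he =>
    (hUmem _).2 ⟨hw2 e he, Or.inr (mem_image_of_mem _ he)⟩
  have hU1 : ∀ e ∈ E, ¬ e.1 = w → e.1 ∈ U := fun e he h =>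
    (hUmem _).2 ⟨h, Or.inl (mem_image_of_mem _ he)⟩
  have hwU : w ∉ U := fun h => ((hUmem w).1 h).1 rfl
  -- the sub-vertex type `Option U` embedded into `Fin m` (`none ↦ w`)
  have hιinj : Function.Injective (fun o : Option {i // i ∈ U} => o.elim w fun j => j.1) := by
    rintro (_ | j) (_ | j') h
    · rfl
    all_goals simp only [Option.elim] at h
    · exact absurd h.symm ((hUmem _).1 j'.2).1
    · exact absurd h ((hUmem _).1 j.2).1
    · rw [Subtype.ext h]
  obtain ⟨ι, hιn, hιs⟩ : ∃ ι : Option {i // i ∈ U} ↪ Fin m,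
      ι none = w ∧ ∀ j, ι (some j) = j.1 := ⟨⟨_, hιinj⟩, rfl, fun _ => rfl⟩
  obtain ⟨ev, hevU, hevw⟩ :
      ∃ ev : (Option {i // i ∈ U} → ZMod (n + 1)) → Fin m → ZMod (n + 1),
        (∀ y i (h : i ∈ U), ev y i = y (some ⟨i, h⟩)) ∧ ∀ y, ev y w = y none :=
    ⟨fun y i => if h : i ∈ U then y (some ⟨i, h⟩) else y none, fun y i h => dif_pos h,
      fun y => dif_neg hwU⟩
  obtain ⟨ext, hext⟩ :
      ∃ ext : ({i // i ∈ U} ↪ ZMod (n + 1)) → Fin m → ZMod (n + 1),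
        ∀ u i (h : i ∈ U), ext u i = u ⟨i, h⟩ :=
    ⟨fun u i => if h : i ∈ U then u ⟨i, h⟩ else 0, fun u i h => dif_pos h⟩
  obtain ⟨Φ, hΦ⟩ : ∃ Φ : (Fin m → ZMod (n + 1)) → ℝ,
      ∀ v, Φ v = ∏ e ∈ E, (quadraticChar (ZMod (n + 1)) (v e.1 - v e.2) : ℝ) :=
    ⟨_, fun _ => rfl⟩
  have hB : ∀ x : Fin m ↪ ZMod (n + 1),
      (∏ e ∈ E, (if (paleyGraph (n + 1)).Adj (x e.1) (x e.2) then (1 : ℝ) else -1)) = Φ x := by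
    intro x
    rw [hΦ]
    refine prod_congr rfl fun e he => ?_
    have hxne : x e.1 ≠ x e.2 := fun h => (hlt e he).ne (x.injective h)
    have hiff := paleyGraph_adj_iff_quadraticChar n h4 (x e.1) (x e.2)
    by_cases hadj : (paleyGraph (n + 1)).Adj (x e.1) (x e.2)
    · rw [if_pos hadj, (hiff.1 hadj).2, Int.cast_one]
    · rcases quadraticChar_dichotomy (sub_ne_zero.2 hxne) with h | h
      · exact absurd (hiff.2 ⟨hxne, h⟩) hadj
      · rw [if_neg hadj, h]
        norm_num
  have hΦU : ∀ v v' : Fin m → ZMod (n + 1), (∀ i ∈ U, v i = v' i) → v w = v' w →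
      Φ v = Φ v' := by
    intro v v' hU hw
    rw [hΦ, hΦ]
    refine prod_congr rfl fun e he => ?_
    have h1 : v e.1 = v' e.1 := if h : e.1 = w then h ▸ hw else hU _ (hU1 e he h)
    rw [h1, hU _ (hU2 e he)]
  -- Step 1: support reduction to `Option U`
  obtain ⟨g, hg⟩ : ∃ g : (Option {i // i ∈ U} ↪ ZMod (n + 1)) → ℝ, ∀ y, g y = Φ (ev y) :=
    ⟨_, fun _ => rfl⟩
  have hfg : ∀ x : Fin m ↪ ZMod (n + 1),
      (∏ e ∈ E, (if (paleyGraph (n + 1)).Adj (x e.1) (x e.2) then (1 : ℝ) else -1)) =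
        g (ι.trans x) := by
    intro x
    rw [hB, hg]
    exact hΦU _ _ (fun i hiU => by rw [hevU _ i hiU, Function.Embedding.trans_apply, hιs])
      (by rw [hevw, Function.Embedding.trans_apply, hιn])
  rw [Fintype.sum_congr _ _ hfg]
  refine abs_sum_embedding_trans_le ι g ?_
  -- Step 2: factor the restricted summand: apex edges `Ew` (first coordinate `w`) and the rest
  obtain ⟨Ew, E', hEw, hE', hsplit, hEwk⟩ : ∃ Ew E' : Finset (Fin m × Fin m),
      (∀ e, e ∈ Ew ↔ e ∈ E ∧ e.1 = w) ∧ (∀ e, e ∈ E' ↔ e ∈ E ∧ ¬ e.1 = w) ∧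
      (∀ f : Fin m × Fin m → ℝ, ∏ e ∈ E, f e = (∏ e ∈ Ew, f e) * ∏ e ∈ E', f e) ∧
      Ew.card ≤ k :=
    ⟨E.filter (fun e => e.1 = w), E.filter (fun e => ¬ e.1 = w), fun e => mem_filter,
      fun e => mem_filter, fun f => (prod_filter_mul_prod_filter_not E _ f).symm,
      (card_filter_le _ _).trans hEk⟩
  have hEwne : Ew.Nonempty := by
    obtain ⟨e, he, h⟩ := mem_image.1 hwA
    exact ⟨e, (hEw e).2 ⟨he, h⟩⟩
  obtain ⟨Φ₂, hΦ₂⟩ : ∃ Φ₂ : ({i // i ∈ U} ↪ ZMod (n + 1)) → ℝ, ∀ u, Φ₂ u =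
      (quadraticChar (ZMod (n + 1)) (∏ e ∈ E', (ext u e.1 - ext u e.2)) : ℝ) :=
    ⟨_, fun _ => rfl⟩
  have hΦ₂1 : ∀ u, |Φ₂ u| ≤ 1 := fun u => by rw [hΦ₂]; exact abs_quadraticChar_le_one _
  have hRinj : ∀ u : {i // i ∈ U} ↪ ZMod (n + 1),
      Set.InjOn (fun e : Fin m × Fin m => ext u e.2) Ew := by
    intro u e he e' he' h
    obtain ⟨heE, he1⟩ := (hEw e).1 he
    obtain ⟨heE', he1'⟩ := (hEw e').1 he'
    have h' : ext u e.2 = ext u e'.2 := h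
    rw [hext _ _ (hU2 e heE), hext _ _ (hU2 e' heE')] at h'
    exact Prod.ext (he1.trans he1'.symm) (congrArg Subtype.val (u.injective h'))
  have hgy : ∀ y : Option {i // i ∈ U} ↪ ZMod (n + 1), g y =
      (quadraticChar (ZMod (n + 1))
          (∏ e ∈ Ew, (y none - ext (Function.Embedding.some.trans y) e.2)) : ℝ) *
        Φ₂ (Function.Embedding.some.trans y) := by
    intro y
    rw [hg, hΦ, hsplit]
    congr 1
    · rw [map_prod, Int.cast_prod]
      refine prod_congr rfl fun e he => ?_
      obtain ⟨heE, he1⟩ := (hEw e).1 he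
      rw [he1, hevw, hevU _ _ (hU2 e heE), hext _ _ (hU2 e heE)]
      rfl
    · rw [hΦ₂, map_prod, Int.cast_prod]
      refine prod_congr rfl fun e he => ?_
      obtain ⟨heE, he1⟩ := (hE' e).1 he
      rw [hevU _ _ (hU1 e heE he1), hevU _ _ (hU2 e heE), hext _ _ (hU1 e heE he1),
        hext _ _ (hU2 e heE)]
      rfl
  rw [Fintype.sum_congr _ _ hgy]
  -- Step 3: Weil, apex last
  refine (abs_sum_option_embedding_le n h4 Ew hEwne (fun u e => ext u e.2) hRinj Φ₂ hΦ₂1).trans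
    ?_
  -- Step 4: numerics
  have hUle : Fintype.card {i // i ∈ U} ≤ Fintype.card (ZMod (n + 1)) := by
    rw [Fintype.card_coe, ZMod.card]; nlinarith
  rw [Fintype.card_embedding_eq, Fintype.card_embedding_eq, Fintype.card_option,
    Nat.descFactorial_succ, Nat.cast_mul, Nat.cast_sub hUle, Fintype.card_coe, ZMod.card,
    ← mul_assoc]
  refine mul_le_mul_of_nonneg_right ?_ (Nat.cast_nonneg _)
  have hp0 : (0 : ℝ) < (n : ℝ) + 1 := by positivity
  set s : ℝ := Real.sqrt (n + 1) with hs
  have hs0 : 0 < s := Real.sqrt_pos.2 hp0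
  have hss : s * s = n + 1 := Real.mul_self_sqrt hp0.le
  have hs4 : 4 * (k : ℝ) ≤ s := by
    rw [hs, show (4 : ℝ) * k = Real.sqrt ((4 * k) ^ 2) by rw [Real.sqrt_sq (by positivity)]]
    exact Real.sqrt_le_sqrt (by exact_mod_cast (show (4 * k) ^ 2 ≤ n + 1 by nlinarith))
  have hk1 : (1 : ℝ) ≤ k := by exact_mod_cast hk
  have ha : (Ew.card : ℝ) ≤ k := by exact_mod_cast hEwk
  have hc : (U.card : ℝ) + 1 ≤ 2 * k := by exact_mod_cast hUk
  rw [div_mul_eq_mul_div, le_div_iff₀ hs0]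
  push_cast
  rw [← hss]
  nlinarith [mul_le_mul_of_nonneg_right ha (mul_self_nonneg s),
    mul_le_mul_of_nonneg_right hc hs0.le, mul_le_mul_of_nonneg_left hs4 (Nat.cast_nonneg U.card),
    mul_le_mul_of_nonneg_left hs4 (by positivity : (0 : ℝ) ≤ 2 * k),
    mul_le_mul hs4 hs4 (by positivity) hs0.le]

/-- **Stub (N) `stub_paleyPatternBias` of line `weil-patch-transfer` (crux `PaleySosRung`,
stmt-PneNP-9817): the random injective patch of the Paley graph is `k`-wise small-biased.** For
every `k` there is `C ≥ 0` (here `C = 8k`) such that for all primes `p ≡ 1 (mod 4)`, all `m` and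
every nonempty set `E` of `≤ k` ordered pairs `(a < b)` of `Fin m`,
`|Σ_{x : Fin m ↪ Fin p} Π_{(a,b) ∈ E} sgn(x a ∼ x b)| ≤ (C/√p) · #(Fin m ↪ Fin p)` (for `p ≥ 16k²`
by `abs_sum_pattern_le_of_le`, for `p < 16k²` by the trivial bound `|Σ| ≤ #`). [folklore] -/
theorem stub_paleyPatternBias :
    ∀ k : ℕ, ∃ C : ℝ, 0 ≤ C ∧ ∀ p : ℕ, p.Prime → p % 4 = 1 → ∀ (m : ℕ)
      [DecidableRel (paleyGraph p).Adj] (E : Finset (Fin m × Fin m)),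
      E.Nonempty → E.card ≤ k → (∀ e ∈ E, e.1 < e.2) →
        |∑ x : (Fin m ↪ Fin p),
            ∏ e ∈ E, (if (paleyGraph p).Adj (x e.1) (x e.2) then (1 : ℝ) else -1)|
          ≤ C / Real.sqrt p * Fintype.card (Fin m ↪ Fin p) := by
  intro k
  refine ⟨8 * k, by positivity, ?_⟩
  intro p hp h4 m inst E hne hEk hlt
  obtain ⟨n, rfl⟩ : ∃ n, p = n + 1 := ⟨p - 1, (Nat.succ_pred_eq_of_pos hp.pos).symm⟩
  haveI : Fact (n + 1).Prime := ⟨hp⟩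
  by_cases hsmall : n + 1 < 16 * k ^ 2
  · -- small `p`: the trivial bound
    have h1 : ∀ x : Fin m ↪ Fin (n + 1),
        |∏ e ∈ E, (if (paleyGraph (n + 1)).Adj (x e.1) (x e.2) then (1 : ℝ) else -1)| ≤ 1 :=
      fun x => by
        rw [Finset.abs_prod]
        exact prod_le_one (fun e _ => abs_nonneg _) fun e _ => by split_ifs <;> simp
    have h2 : Real.sqrt ((n + 1 : ℕ) : ℝ) ≤ 8 * k := by
      have h16 : ((n + 1 : ℕ) : ℝ) ≤ (4 * k) ^ 2 := by
        exact_mod_cast (show n + 1 ≤ (4 * k) ^ 2 by nlinarith)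
      calc Real.sqrt ((n + 1 : ℕ) : ℝ) ≤ Real.sqrt ((4 * k) ^ 2) := Real.sqrt_le_sqrt h16
        _ = 4 * k := Real.sqrt_sq (by positivity)
        _ ≤ 8 * k := by linarith [(Nat.cast_nonneg k : (0 : ℝ) ≤ k)]
    calc _ ≤ ∑ _x : Fin m ↪ Fin (n + 1), (1 : ℝ) :=
          (abs_sum_le_sum_abs _ _).trans (sum_le_sum fun x _ => h1 x)
      _ = 1 * Fintype.card (Fin m ↪ Fin (n + 1)) := by simp
      _ ≤ 8 * k / Real.sqrt ((n + 1 : ℕ) : ℝ) * Fintype.card (Fin m ↪ Fin (n + 1)) :=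
          mul_le_mul_of_nonneg_right ((one_le_div (Real.sqrt_pos.2 (by positivity))).2 h2)
            (Nat.cast_nonneg _)
  · -- large `p`
    have h := abs_sum_pattern_le_of_le n h4 (not_lt.1 hsmall) hne hEk hlt
    push_cast
    exact h

end Summit.PneNP.PneNP.Theorems.PaleySosRungWeilPatch
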